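import Summits.AtomisticToContinuum.Crystallization.Theorems.OverbindingBudgetBalancedLayered

/-!
# OverbindingBudget — R1-N: the two-shell PATTERN SCALE widened to `[9/10, 103/100]` along the whole slot-4 → door chain (lens-4 g29, part XVI)

Helper file (`--supports stmt-AtomisticToContinuum-31280`).  Critic row 440 (census TAG 157 KR2-LIT, variant L): the literal certificate
target of slot 4, `TightDozenRigidity (1/250)` (conclusion `IsTwoShellGoodSetGap (3/50) (1/500) (9/10) 1`), is CONSISTENT but THIN —
an RT-admissible affine strain `diag(0.034, 0.014, 0.014)` of fcc satisfies every hypothesis and deviates by `√2·0.034 = 0.0481` at the caps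
against the budget `3/50 = 0.060`, because the pattern scale is pinned to `a′ ≤ 1` while `RT` admits far-field dilation `1.024`.  Ruling (3):
R1-N — widen the pattern-scale window to `aHi = 103/100` on BOTH sides (lens-3 g23 ANSWER: N's line is scale-covariant, `a′ ≤ 1` load-bearing
nowhere; IND farm-checked at `103/100`).  This file is the lens-4 half:

* §1 the widened statements: `TightDozenRigidityW` (slot 4, WEAKER than the literal: expected sup `≈ 0.02`, margin `≈ 65 %`),
  `LocalTwoShellRigidityW`, `ChargeFreeBallRigidityW`, `CleanTwoShellW`, and the widened DOOR `IsCleanW / IsDoorSetW / DoorPeriodicW Λ`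
  (N's binders with `IsTwoShellGoodSet (1/16) (9/10) (103/100)`), `CleanChartedW`, `BalancedLayeredCleanW` — the last three are STRONGER than
  their `aHi = 1` originals (weaker cleanliness hypothesis; scale-covariant content), proved so in §2 together with `tightDozenRigidity_imp_W`.
* §3 the chain re-run at `103/100`: the transfer lemma `isTwoShellGoodSet_of_match103` (the `aHi ≤ 1` side condition of
  `isTwoShellGoodSet_of_match` relaxed to `103/100`: pattern images still lie in `B(p, 3)` since `√2·1.03 + 1.03/4 < 3`),
  `localTwoShellRigidityW_of_tightW`, `chargeFreeBallRigidityW_of_local`, `cleanTwoShellW_of_ballPieces`, `optimalTexturePeriodic_of_doorPeriodicW`,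
  `layeredCleanOrStrained_of_balancedW`.
* §4 the cone, **eleventh form**: `rdef_of_grossU_doorPeriodicW_balanced (Λ) : GrossCleanBallsU (1/250) 10 → ChargedEnergyGap →
  CompressedVirialLaw (1/250) 10 → TightDozenRigidityW (1/250) → CleanChartedW (1/250) 10 → DoorPeriodicW Λ → BalancedLayeredCleanW Λ →
  CleanlessExcessT → CoherentResidual 10 → RobustDefectLimitWindows`.  Part XV's cut beneath slot 7 lifts verbatim (`IsClean ↦ IsCleanW`).
No `sorry`, no new axioms, no `instance` / `notation`; `[folklore]` bookkeeping only.
-/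

noncomputable section

namespace Summit.AtomisticToContinuum.Crystallization.Theorems.OverbindingBudgetScaleWidening

open scoped Classical
open MeasureTheory
open Literature.MathematicalPhysics.StatisticalMechanics (UniformlyDiscrete Match)
open Literature.Geometry.DiscreteGeometry (IsTwoShellGoodSet IsChargeFree bondGraph fccTwoShellPattern hcpTwoShellPattern
  norm_le_sqrt_two_of_mem_twoShellPattern one_le_dist_of_mem_fccTwoShellPattern one_le_dist_of_mem_hcpTwoShellPattern)
open Summit.AtomisticToContinuum.Crystallization.Theses.OverbindingBudget (RobustDefectLimitWindows)
open Summit.AtomisticToContinuum.Crystallization.Theses.PricedLinkCensus (ChargedEnergyGap)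
open Summit.AtomisticToContinuum.Crystallization.Theorems.OverbindingBudgetGradedBareness (CleanlessExcessT)
open Summit.AtomisticToContinuum.Crystallization.Theorems.OverbindingBudgetCoherentCut (CoherentResidual)
open Summit.AtomisticToContinuum.Crystallization.Theorems.OverbindingBudgetUniformCutStatements (GrossCleanBallsU)
open Summit.AtomisticToContinuum.Crystallization.Theorems.OverbindingBudgetViolatorDensityFloor (RT)
open Summit.AtomisticToContinuum.Crystallization.Theorems.OverbindingBudgetEdgeRelaxationStatements (CleanClass StrainedCubes)
open Summit.AtomisticToContinuum.Crystallization.Theorems.OverbindingBudgetElasticSplitStatements (SparseCharge LocallyOptimal VirialBalanced)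
open Summit.AtomisticToContinuum.Crystallization.Theorems.OverbindingBudgetElasticSplitScale (HasCompressedScale CompressedVirialLaw)
open Summit.AtomisticToContinuum.Crystallization.Theorems.OverbindingBudgetElasticSplitShear (StressFree)
open Summit.AtomisticToContinuum.Crystallization.Theorems.OverbindingBudgetElasticSplitPeriodic (OptimalTexturePeriodic Unstrained
  unstrained_or_strained virialBalanced_of_unstrained stressFree_of_unstrained rdef_of_grossU_periodicSplit)
open Summit.AtomisticToContinuum.Crystallization.Theorems.OverbindingBudgetElasticSplitDoorBridge (CleanTwoShell CleanCharted
  setOf_μS_singleton_ne_zero isClean_μS_iff)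
open Summit.AtomisticToContinuum.Crystallization.Theorems.OverbindingBudgetLiouvilleDictionary (isNash_of_locallyOptimal)
open Summit.AtomisticToContinuum.Crystallization.Theorems.ChartedPlanarOrderRigidityDoor (IsClean IsNash IsCharted)
open Summit.AtomisticToContinuum.Crystallization.Theorems.ChartedPlanarOrderDensityDichotomy (μS IsSep)
open Summit.AtomisticToContinuum.Crystallization.Theorems.ChartedPlanarOrderMesoCut (IsDoorSet)
open Summit.AtomisticToContinuum.Crystallization.Theorems.ChartedPlanarOrderDoorLayered (Layered DoorPeriodic TwoPeriodic)
open Summit.AtomisticToContinuum.Crystallization.Theorems.OverbindingBudgetTwoShellTransfer (IsTwoShellGoodSetGap LimitChargeFreeBall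
  ChargeFreeBallNear ChargeFreeBallRigidity LocalTwoShellRigidity sep_of_cleanClass)
open Summit.AtomisticToContinuum.Crystallization.Theorems.OverbindingBudgetLimitChargeFreeBall (limitChargeFreeBall_holds)
open Summit.AtomisticToContinuum.Crystallization.Theorems.OverbindingBudgetRTDictionary (shellY exists_eq_of_dist_lt_two mem_of_range
  dist_le_of_mem_neighborSet deep_of_dist_le)
open Summit.AtomisticToContinuum.Crystallization.Theorems.OverbindingBudgetTightDozen (TightDozen TightDozenRigidity tightDozen_of_chargeFree)
open Summit.AtomisticToContinuum.Crystallization.Theorems.OverbindingBudgetPeriodicCleanOrStrained (UniformlyClean LayeredCleanOrStrained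
  periodicStrainedCubes_of_layered)
open Summit.AtomisticToContinuum.Crystallization.Theorems.OverbindingBudgetBalancedLayered (BalancedLayeredClean)

/-! ## §1 The widened statements (`aHi = 103/100`) -/

/-- **Slot 4, widened: `TightDozenRigidityW T₀`** — the hypotheses of `TightDozenRigidity T₀` verbatim, the pattern scale allowed up to
`103/100` (absorbing the RT-admissible far-field dilation `1.024`). [WEAKER than the literal; UNDECIDED·TRUE-type; CERT; TAG 157.] [piece] -/
def TightDozenRigidityW (T₀ : ℝ) : Prop :=
  ∀ (a : ℝ) (Y : Set (EuclideanSpace ℝ (Fin 3))) (q : EuclideanSpace ℝ (Fin 3)), 47 / 50 ≤ a → a ≤ 1 → q ∈ Y →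
    (∀ w ∈ Y, RT a T₀ Y w) → TightDozen a T₀ Y q → (∀ p ∈ shellY a T₀ Y q, TightDozen a T₀ Y p) →
    IsTwoShellGoodSetGap (3 / 50) (1 / 500) (9 / 10) (103 / 100) Y q

/-- `LocalTwoShellRigidity T₀ D` with the widened conclusion. [piece] -/
def LocalTwoShellRigidityW (T₀ D : ℝ) : Prop :=
  ∀ Y : Set (EuclideanSpace ℝ (Fin 3)), CleanClass T₀ D Y → ¬ HasCompressedScale T₀ Y →
    ∀ (c : EuclideanSpace ℝ (Fin 3)) (ℓ : ℝ) (N : ℕ) (y : Fin N → EuclideanSpace ℝ (Fin 3)) (i : Fin N),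
      Function.Injective y → Set.range y = Y ∩ {z | ∀ j : Fin 3, c j ≤ z j ∧ z j < c j + ℓ} →
      (∀ j : Fin 3, c j + 7 ≤ y i j ∧ y i j + 7 ≤ c j + ℓ) → (∀ i' : Fin N, dist (y i') (y i) ≤ 3 → IsChargeFree (1 / 100 : ℝ) y i') →
      IsTwoShellGoodSetGap (3 / 50) (1 / 500) (9 / 10) (103 / 100) Y (y i)

/-- `ChargeFreeBallRigidity T₀ D` with the widened conclusion. [piece] -/
def ChargeFreeBallRigidityW (T₀ D : ℝ) : Prop :=
  ∀ Y : Set (EuclideanSpace ℝ (Fin 3)), CleanClass T₀ D Y → ¬ HasCompressedScale T₀ Y →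
    ∀ q ∈ Y, (∀ ε : ℝ, 0 < ε → ChargeFreeBallNear Y q ε) → IsTwoShellGoodSet (1 / 16) (9 / 10) (103 / 100) Y q

/-- B₁ widened: `CleanTwoShell T₀ D` with goodness at pattern scale `≤ 103/100`. [piece] -/
def CleanTwoShellW (T₀ D : ℝ) : Prop :=
  ∀ Y : Set (EuclideanSpace ℝ (Fin 3)), CleanClass T₀ D Y → ¬ HasCompressedScale T₀ Y → SparseCharge Y → LocallyOptimal Y → Unstrained Y →
    ∀ q ∈ Y, IsTwoShellGoodSet (1 / 16) (9 / 10) (103 / 100) Y q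

/-- B₂ widened (STRONGER than `CleanCharted`: weaker cleanliness hypothesis): goodness at scale `≤ 103/100` everywhere ⇒ Barlow-bond-charted. [piece] -/
def CleanChartedW (T₀ D : ℝ) : Prop :=
  ∀ Y : Set (EuclideanSpace ℝ (Fin 3)), CleanClass T₀ D Y → ¬ HasCompressedScale T₀ Y → SparseCharge Y → LocallyOptimal Y → Unstrained Y →
    (∀ q ∈ Y, IsTwoShellGoodSet (1 / 16) (9 / 10) (103 / 100) Y q) → IsCharted (μS Y)

/-- N's cleanliness binder, widened: every atom `(1/16, 9/10, 103/100)`-two-shell-good. -/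
def IsCleanW (μ : Measure (EuclideanSpace ℝ (Fin 3))) : Prop :=
  ∀ q : EuclideanSpace ℝ (Fin 3), μ {q} ≠ 0 → IsTwoShellGoodSet (1 / 16) (9 / 10) (103 / 100) {p : EuclideanSpace ℝ (Fin 3) | μ {p} ≠ 0} q

/-- N's door set, widened (`IsClean ↦ IsCleanW`). -/
def IsDoorSetW (δ : ℝ) (S : Set (EuclideanSpace ℝ (Fin 3))) : Prop :=
  (0 : EuclideanSpace ℝ (Fin 3)) ∈ S ∧ IsSep δ S ∧ IsCleanW (μS S) ∧ IsNash (μS S) ∧ IsCharted (μS S)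

/-- **Slot 6, widened: `DoorPeriodicW Λ`** — N's exact Liouville statement on the widened door sets (STRONGER than `DoorPeriodic Λ`; lens-3 g23:
scale-covariant, same constants). [piece] -/
def DoorPeriodicW (Λ : ℝ) : Prop :=
  ∀ δ : ℝ, 0 < δ → ∀ S : Set (EuclideanSpace ℝ (Fin 3)), IsDoorSetW δ S → TwoPeriodic Λ S

/-- **Slot 7, widened: `BalancedLayeredCleanW Λ`** (`IsClean ↦ IsCleanW`; STRONGER than `BalancedLayeredClean Λ`). [piece] -/
def BalancedLayeredCleanW (Λ : ℝ) : Prop :=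
  ∀ δ : ℝ, 0 < δ → ∀ (a b : EuclideanSpace ℝ (Fin 3)) (w : ℤ → EuclideanSpace ℝ (Fin 3)), LinearIndependent ℝ ![a, b] → ‖a‖ ≤ Λ → ‖b‖ ≤ Λ →
    IsSep δ (Layered a b w) → IsCleanW (μS (Layered a b w)) → IsNash (μS (Layered a b w)) →
    VirialBalanced (Layered a b w) → StressFree (Layered a b w) → UniformlyClean (Layered a b w)

/-! ## §2 Monotonicity in the pattern-scale window -/

/-- Goodness is monotone in `aHi`. [folklore] -/
theorem isTwoShellGoodSet_widen {ε aLo aHi aHi' : ℝ} (hle : aHi ≤ aHi') {Y : Set (EuclideanSpace ℝ (Fin 3))} {q : EuclideanSpace ℝ (Fin 3)}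
    (h : IsTwoShellGoodSet ε aLo aHi Y q) : IsTwoShellGoodSet ε aLo aHi' Y q := by
  obtain ⟨a, ha₁, ha₂, rest⟩ := h
  exact ⟨a, ha₁, ha₂.trans hle, rest⟩

/-- Goodness with gap is monotone in `aHi`. [folklore] -/
theorem isTwoShellGoodSetGap_widen {ε g aLo aHi aHi' : ℝ} (hle : aHi ≤ aHi') {Y : Set (EuclideanSpace ℝ (Fin 3))}
    {q : EuclideanSpace ℝ (Fin 3)} (h : IsTwoShellGoodSetGap ε g aLo aHi Y q) : IsTwoShellGoodSetGap ε g aLo aHi' Y q := by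
  obtain ⟨a, ha₁, ha₂, rest⟩ := h
  exact ⟨a, ha₁, ha₂.trans hle, rest⟩

/-- **The literal slot 4 implies the widened one.** [this file] -/
theorem tightDozenRigidity_imp_W {T₀ : ℝ} (h : TightDozenRigidity T₀) : TightDozenRigidityW T₀ :=
  fun a Y q ha ha1 hq hRT hd hN => isTwoShellGoodSetGap_widen (by norm_num) (h a Y q ha ha1 hq hRT hd hN)

/-- `LocalTwoShellRigidity → LocalTwoShellRigidityW`. [this file] -/
theorem localTwoShellRigidity_imp_W {T₀ D : ℝ} (h : LocalTwoShellRigidity T₀ D) : LocalTwoShellRigidityW T₀ D :=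
  fun Y hY hnc c ℓ N y i hy hr hdeep hcf => isTwoShellGoodSetGap_widen (by norm_num) (h Y hY hnc c ℓ N y i hy hr hdeep hcf)

/-- `CleanTwoShell → CleanTwoShellW`. [this file] -/
theorem cleanTwoShell_imp_W {T₀ D : ℝ} (h : CleanTwoShell T₀ D) : CleanTwoShellW T₀ D :=
  fun Y hY hnc hsc hlo hu q hq => isTwoShellGoodSet_widen (by norm_num) (h Y hY hnc hsc hlo hu q hq)

/-- `IsClean μ → IsCleanW μ`. [this file] -/
theorem isClean_imp_W {μ : Measure (EuclideanSpace ℝ (Fin 3))} (h : IsClean μ) : IsCleanW μ :=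
  fun q hq => isTwoShellGoodSet_widen (by norm_num) (h q hq)

/-- `IsDoorSet δ S → IsDoorSetW δ S`. [this file] -/
theorem isDoorSet_imp_W {δ : ℝ} {S : Set (EuclideanSpace ℝ (Fin 3))} (h : IsDoorSet δ S) : IsDoorSetW δ S :=
  ⟨h.1, h.2.1, isClean_imp_W h.2.2.1, h.2.2.2.1, h.2.2.2.2⟩

/-- **The widened door is STRONGER:** `DoorPeriodicW Λ → DoorPeriodic Λ`. [this file] -/
theorem doorPeriodic_of_W {Λ : ℝ} (h : DoorPeriodicW Λ) : DoorPeriodic Λ :=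
  fun δ hδ S hS => h δ hδ S (isDoorSet_imp_W hS)

/-- `CleanChartedW → CleanCharted`. [this file] -/
theorem cleanCharted_of_W {T₀ D : ℝ} (h : CleanChartedW T₀ D) : CleanCharted T₀ D :=
  fun Y hY hnc hsc hlo hu h2 => h Y hY hnc hsc hlo hu fun q hq => isTwoShellGoodSet_widen (by norm_num) (h2 q hq)

/-- `BalancedLayeredCleanW Λ → BalancedLayeredClean Λ`. [this file] -/
theorem balancedLayeredClean_of_W {Λ : ℝ} (h : BalancedLayeredCleanW Λ) : BalancedLayeredClean Λ :=
  fun δ hδ a b w hab ha hb hs hc hn hv hf => h δ hδ a b w hab ha hb hs (isClean_imp_W hc) hn hv hf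

/-! ## §3 The chain at pattern scale `103/100` -/

/-- `{p | μS Y {p} ≠ 0} = Y` makes `IsCleanW (μS Y)` the pointwise statement. [this file] -/
theorem isCleanW_μS_iff (Y : Set (EuclideanSpace ℝ (Fin 3))) :
    IsCleanW (μS Y) ↔ ∀ q ∈ Y, IsTwoShellGoodSet (1 / 16) (9 / 10) (103 / 100) Y q := by
  unfold IsCleanW
  rw [setOf_μS_singleton_ne_zero Y]
  constructor
  · intro h q hq
    exact h q (by have := (Set.ext_iff.mp (setOf_μS_singleton_ne_zero Y) q).mpr hq; exact this)
  · intro h q hq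
    exact h q ((Set.ext_iff.mp (setOf_μS_singleton_ne_zero Y) q).mp hq)

set_option maxHeartbeats 1600000 in
/-- **Transfer at `aHi ≤ 103/100`** (the proof of `isTwoShellGoodSet_of_match` with the one scale-dependent estimate re-budgeted:
`‖a • A v‖ ≤ √2·(103/100) ≤ 3/2`). [this file] -/
theorem isTwoShellGoodSet_of_match103 {Y : Set (EuclideanSpace ℝ (Fin 3))} {p q : EuclideanSpace ℝ (Fin 3)} {η g aLo aHi ε η' δ₀ : ℝ}
    (hsep : ∀ x ∈ Y, ∀ y ∈ Y, x ≠ y → δ₀ ≤ dist x y) (hq : q ∈ Y) (hp : IsTwoShellGoodSetGap η g aLo aHi Y p)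
    (hM : Match ε 3 0 ((fun x => x - p) '' Y) ((fun x => x - q) '' Y)) (hε : 0 ≤ ε) (h2ε : 2 * ε < δ₀) (hεg : ε ≤ g) (haLo : 0 < aLo)
    (haHi : aHi ≤ 103 / 100) (hη0 : 0 ≤ η) (hη1 : η ≤ 1 / 4) (hinj : 2 * ε < aLo * (1 - 2 * η)) (hη' : η + ε / aLo ≤ η') :
    IsTwoShellGoodSet η' aLo aHi Y q := by
  obtain ⟨a, ha₁, ha₂, A, P, f, hP, hf, hinjf, hcov⟩ := hp
  have ha0 : 0 < a := haLo.trans_le ha₁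
  have ha1 : a ≤ 103 / 100 := ha₂.trans haHi
  have hsqrt : Real.sqrt 2 ≤ 71 / 50 := by
    rw [show (71 / 50 : ℝ) = Real.sqrt ((71 / 50) ^ 2) from (Real.sqrt_sq (by norm_num)).symm]
    exact Real.sqrt_le_sqrt (by norm_num)
  -- the pattern images lie in `B(p, 3)`
  have hfp : ∀ v ∈ P, dist (f v - p) 0 ≤ 3 := by
    intro v hv
    have h1 : ‖a • A v‖ ≤ 3 / 2 := by
      rw [norm_smul, Real.norm_eq_abs, abs_of_pos ha0, A.norm_map]
      have hv2 := norm_le_sqrt_two_of_mem_twoShellPattern hP hv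
      have hv3 : ‖v‖ ≤ 71 / 50 := hv2.trans hsqrt
      nlinarith [norm_nonneg v]
    have h2 : dist (f v) (p + a • A v) ≤ η * a := (hf v hv).2
    rw [dist_zero_right]
    have e : f v - p = (f v - (p + a • A v)) + a • A v := by abel
    rw [e]
    have h3 : ‖f v - (p + a • A v)‖ ≤ η * a := by rwa [← dist_eq_norm]
    have h4 : η * a ≤ 1 := by nlinarith
    exact (norm_add_le _ _).trans (by linarith)
  -- push the chart through the matching
  have key : ∀ v ∈ P, ∃ y ∈ Y, dist (f v - p) (y - q) ≤ ε := by
    intro v hv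
    obtain ⟨s, ⟨y, hy, rfl⟩, hd⟩ := hM.2 (f v - p) ⟨f v, (hf v hv).1, rfl⟩ (hfp v hv)
    exact ⟨y, hy, hd⟩
  choose! f' hf'Y hf'd using key
  refine ⟨a, ha₁, ha₂, A, P, f', hP, fun v hv => ⟨hf'Y v hv, ?_⟩, ?_, ?_⟩
  · -- tolerance
    have h1 : dist (f v) (p + a • A v) ≤ η * a := (hf v hv).2
    have h2 := hf'd v hv
    rw [dist_eq_norm] at h1 h2 ⊢
    have e : f' v - (q + a • A v) = (f v - (p + a • A v)) - (f v - p - (f' v - q)) := by abel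
    rw [e]
    have h3 : ε ≤ ε / aLo * a := by
      rw [div_mul_eq_mul_div, le_div_iff₀ haLo]
      exact mul_le_mul_of_nonneg_left ha₁ hε
    have h4 : (η + ε / aLo) * a ≤ η' * a := mul_le_mul_of_nonneg_right hη' ha0.le
    calc ‖(f v - (p + a • A v)) - (f v - p - (f' v - q))‖ ≤ η * a + ε := (norm_sub_le _ _).trans (add_le_add h1 h2)
      _ ≤ η' * a := by nlinarith
  · -- injectivity
    intro v hv w hw hvw
    by_contra hne
    have h1 : 1 ≤ dist v w := by
      rcases hP with rfl | rfl
      · exact one_le_dist_of_mem_fccTwoShellPattern hv hw hne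
      · exact one_le_dist_of_mem_hcpTwoShellPattern hv hw hne
    have h2 : dist (a • A v) (a • A w) = a * dist v w := by
      rw [dist_eq_norm, ← smul_sub, norm_smul, Real.norm_eq_abs, abs_of_pos ha0, ← map_sub, A.norm_map, dist_eq_norm]
    have h3 : dist (f v) (f w) ≤ 2 * ε := by
      have e : dist (f v) (f w) = dist (f v - p) (f w - p) := by simp [dist_eq_norm]
      rw [e]
      calc dist (f v - p) (f w - p) ≤ dist (f v - p) (f' v - q) + dist (f' v - q) (f w - p) := dist_triangle _ _ _
        _ ≤ ε + ε := by
            refine add_le_add (hf'd v hv) ?_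
            rw [hvw, dist_comm]; exact hf'd w hw
        _ = 2 * ε := by ring
    have h4 : a * dist v w ≤ dist (f v) (f w) + 2 * (η * a) := by
      rw [← h2]
      have t1 : dist (f v) (p + a • A v) ≤ η * a := (hf v hv).2
      have t2 : dist (f w) (p + a • A w) ≤ η * a := (hf w hw).2
      have e : dist (a • A v) (a • A w) = dist (p + a • A v) (p + a • A w) := by simp [dist_eq_norm]
      rw [e]
      have := dist_triangle4 (p + a • A v) (f v) (f w) (p + a • A w)
      rw [dist_comm] at t1
      linarith
    have h5 : aLo * (1 - 2 * η) ≤ a * (1 - 2 * η) := mul_le_mul_of_nonneg_right ha₁ (by linarith)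
    nlinarith
  · -- covering
    intro y hy hyq hd
    have hy0 : dist (y - q) 0 ≤ 3 := by
      rw [dist_zero_right, ← dist_eq_norm]; nlinarith
    obtain ⟨s, ⟨y', hy', rfl⟩, hd'⟩ := hM.1 (y - q) ⟨y, hy, rfl⟩ hy0
    have hy'p : y' ≠ p := by
      rintro rfl
      have h1 : dist y q ≤ ε := by
        have h := hd'
        simp only [sub_self] at h
        rwa [dist_comm, dist_zero_right, ← dist_eq_norm] at h
      have h2 := hsep y hy q hq hyq
      linarith
    have hd'' : dist y' p ≤ 3 / 2 * a + g := by
      have e : dist y' p = ‖y' - p‖ := dist_eq_norm _ _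
      rw [dist_eq_norm] at hd hd'
      have : ‖y' - p‖ ≤ ‖y' - p - (y - q)‖ + ‖y - q‖ := norm_le_norm_sub_add _ _
      linarith
    obtain ⟨v, hv, hfv⟩ := hcov y' hy' hy'p hd''
    refine ⟨v, hv, ?_⟩
    by_contra hne
    have h1 := hsep (f' v) (hf'Y v hv) y hy hne
    have h2 : dist (f' v) y ≤ 2 * ε := by
      have e : dist (f' v) y = dist (f' v - q) (y - q) := by simp [dist_eq_norm]
      rw [e]
      have t1 : dist (f v - p) (f' v - q) ≤ ε := hf'd v hv
      rw [hfv] at t1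
      calc dist (f' v - q) (y - q) ≤ dist (f' v - q) (y' - p) + dist (y' - p) (y - q) := dist_triangle _ _ _
        _ ≤ ε + ε := add_le_add (by rw [dist_comm]; exact t1) hd'
        _ = 2 * ε := by ring
    linarith

/-- **Seam, PROVED.** `LocalTwoShellRigidityW T₀ D → ChargeFreeBallRigidityW T₀ D` for `T₀ ≤ 1/2` (`ε = 1/500`, as in part XI). [this file] -/
theorem chargeFreeBallRigidityW_of_local {T₀ D : ℝ} (hT : T₀ ≤ 1 / 2) (hloc : LocalTwoShellRigidityW T₀ D) :
    ChargeFreeBallRigidityW T₀ D := by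
  intro Y hY hnc q hq hlim
  obtain ⟨c, ℓ, N, y, i, hinj, hr, hdeep, hfree, hM⟩ := hlim (1 / 500) (by norm_num)
  have hgood := hloc Y hY hnc c ℓ N y i hinj hr hdeep hfree
  have hsep := sep_of_cleanClass hY
  exact isTwoShellGoodSet_of_match103 hsep hq hgood hM (by norm_num) (by linarith) (by norm_num) (by norm_num) le_rfl (by norm_num)
    (by norm_num) (by norm_num) (by norm_num)

/-- **Seam.** `LimitChargeFreeBall → ChargeFreeBallRigidityW → CleanTwoShellW`. [this file] -/
theorem cleanTwoShellW_of_ballPieces {T₀ D : ℝ} (ha : LimitChargeFreeBall T₀ D) (hb : ChargeFreeBallRigidityW T₀ D) : CleanTwoShellW T₀ D :=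
  fun Y hY hnc hsc _ _ q hq => hb Y hY hnc q hq fun ε hε => ha Y hY hsc q hq ε hε

/-- **Seam, PROVED** (`0 ≤ T₀ ≤ 1/250`): `TightDozenRigidityW T₀ → LocalTwoShellRigidityW T₀ D` — the RT ↔ chunk dictionary of parts XI–XII
verbatim (the widening touches only the conclusion). [this file] -/
theorem localTwoShellRigidityW_of_tightW {T₀ D : ℝ} (hT0 : 0 ≤ T₀) (hT : T₀ ≤ 1 / 250) (h : TightDozenRigidityW T₀) :
    LocalTwoShellRigidityW T₀ D := by
  intro Y hY _hnc c ℓ N y i hy hr hdeep hcf3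
  obtain ⟨a, ha, ha1, hRT⟩ := hY.2.2.2.2.2
  have hdeep4 : ∀ j : Fin 3, c j + 4 ≤ y i j ∧ y i j + 4 ≤ c j + ℓ := by
    intro j; obtain ⟨h1, h2⟩ := hdeep j; constructor <;> linarith
  have hdeep2 : ∀ j : Fin 3, c j + 2 ≤ y i j ∧ y i j + 2 ≤ c j + ℓ := by
    intro j; obtain ⟨h1, h2⟩ := hdeep j; constructor <;> linarith
  have hcfi : IsChargeFree (1 / 100 : ℝ) y i := hcf3 i (by rw [dist_self]; norm_num)
  have hcfnbr : ∀ k : Fin N, dist (y i) (y k) ≤ 1.96 → (∀ j : Fin 3, c j + 2 ≤ y k j ∧ y k j + 2 ≤ c j + ℓ) →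
      ∀ m ∈ (bondGraph (1 / 100 : ℝ) y).neighborSet k, IsChargeFree (1 / 100 : ℝ) y m := by
    intro k hk hdeepk m hm
    have hdm := dist_le_of_mem_neighborSet hRT ha1 hT hr hdeepk hm
    refine hcf3 m ?_
    have htri := dist_triangle (y m) (y k) (y i)
    rw [dist_comm (y m) (y k), dist_comm (y k) (y i)] at htri
    nlinarith [htri, hdm, hk, ha1, hT]
  have hdoz := tightDozen_of_chargeFree hRT ha ha1 hT0 hT hy hr hdeep4 hcfi (hcfnbr i (by rw [dist_self]; norm_num) hdeep2)
  refine h a Y (y i) ha ha1 (mem_of_range hr i) hRT hdoz ?_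
  rintro p ⟨hp, hpne, hpd⟩
  obtain ⟨j, rfl⟩ := exists_eq_of_dist_lt_two hr hdeep2 hp (by linarith)
  have hdj : dist (y i) (y j) ≤ 1.96 := by linarith
  have hdeep6 : ∀ k : Fin 3, c k + (4 + 1.96) ≤ y i k ∧ y i k + (4 + 1.96) ≤ c k + ℓ := by
    intro k; obtain ⟨h1, h2⟩ := hdeep k; constructor <;> linarith
  have hdeepj4 : ∀ k : Fin 3, c k + 4 ≤ y j k ∧ y j k + 4 ≤ c k + ℓ := deep_of_dist_le hdeep6 hdj
  have hdeepj2 : ∀ k : Fin 3, c k + 2 ≤ y j k ∧ y j k + 2 ≤ c k + ℓ := by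
    intro k; obtain ⟨h1, h2⟩ := hdeepj4 k; constructor <;> linarith
  have hcfj : IsChargeFree (1 / 100 : ℝ) y j := hcf3 j (by rw [dist_comm]; linarith)
  exact tightDozen_of_chargeFree hRT ha ha1 hT0 hT hy hr hdeepj4 hcfj (hcfnbr j hdj hdeepj2)

/-- A rooted, uniformly discrete, locally optimal texture, `103/100`-two-shell-good everywhere and charted, is a WIDENED door set. [this file] -/
theorem isDoorSetW_of_locallyOptimal {Y : Set (EuclideanSpace ℝ (Fin 3))} (hUD : UniformlyDiscrete Y) (h0 : (0 : EuclideanSpace ℝ (Fin 3)) ∈ Y)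
    (hlo : LocallyOptimal Y) (h2 : ∀ q ∈ Y, IsTwoShellGoodSet (1 / 16) (9 / 10) (103 / 100) Y q) (hch : IsCharted (μS Y)) :
    ∃ δ : ℝ, 0 < δ ∧ IsDoorSetW δ Y := by
  obtain ⟨δ, hδ, hsep⟩ := hUD
  exact ⟨δ, hδ, h0, hsep, (isCleanW_μS_iff Y).2 h2, isNash_of_locallyOptimal hlo, hch⟩

/-- **The convergence edge, widened.** `CleanTwoShellW → CleanChartedW → DoorPeriodicW Λ → OptimalTexturePeriodic Λ T₀ D`. [this file] -/
theorem optimalTexturePeriodic_of_doorPeriodicW {Λ T₀ D : ℝ} (h₁ : CleanTwoShellW T₀ D) (h₂ : CleanChartedW T₀ D) (h : DoorPeriodicW Λ) :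
    OptimalTexturePeriodic Λ T₀ D := by
  intro Y hY hnc hsc hlo hu
  have h2 := h₁ Y hY hnc hsc hlo hu
  obtain ⟨δ, hδ, hdoor⟩ := isDoorSetW_of_locallyOptimal hY.1 hY.2.1 hlo h2 (h₂ Y hY hnc hsc hlo hu h2)
  exact h δ hδ Y hdoor

/-- **E_per seam, widened.** `CleanTwoShellW T₀ D → BalancedLayeredCleanW Λ → LayeredCleanOrStrained Λ T₀ D` (`T₀ ≤ 1/2`). [this file] -/
theorem layeredCleanOrStrained_of_balancedW {Λ T₀ D : ℝ} (hT : T₀ ≤ 1 / 2) (h₁ : CleanTwoShellW T₀ D) (hB : BalancedLayeredCleanW Λ) :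
    LayeredCleanOrStrained Λ T₀ D := by
  intro a b w hab ha hb hY hnc hsc hlo
  rcases unstrained_or_strained (Layered a b w) with hU | hS
  · left
    have hδ : (0 : ℝ) < 47 / 50 * (49 / 50) - T₀ := by linarith
    exact hB _ hδ a b w hab ha hb (sep_of_cleanClass hY) ((isCleanW_μS_iff _).2 (h₁ _ hY hnc hsc hlo hU)) (isNash_of_locallyOptimal hlo)
      (virialBalanced_of_unstrained hU) (stressFree_of_unstrained hY.1 hU)
  · exact Or.inr hS

/-! ## §4 The cone, eleventh form -/

/-- **RDEF cone, eleventh form** (every `Λ`; R1-N of critic rows 434 / 440): `GrossCleanBallsU (1/250) 10 → ChargedEnergyGap →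
CompressedVirialLaw (1/250) 10 → TightDozenRigidityW (1/250) → CleanChartedW (1/250) 10 → DoorPeriodicW Λ → BalancedLayeredCleanW Λ →
CleanlessExcessT → CoherentResidual 10 → RobustDefectLimitWindows`. [this file] -/
theorem rdef_of_grossU_doorPeriodicW_balanced (Λ : ℝ) (hG : GrossCleanBallsU (1 / 250) 10) (hCEG : ChargedEnergyGap)
    (hC : CompressedVirialLaw (1 / 250) 10) (hK : TightDozenRigidityW (1 / 250)) (h₂ : CleanChartedW (1 / 250) 10) (hD : DoorPeriodicW Λ)
    (hB : BalancedLayeredCleanW Λ) (hCE : CleanlessExcessT) (hR : CoherentResidual 10) : RobustDefectLimitWindows :=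
  have h₁ : CleanTwoShellW (1 / 250) 10 :=
    cleanTwoShellW_of_ballPieces (limitChargeFreeBall_holds (1 / 250) 10)
      (chargeFreeBallRigidityW_of_local (by norm_num) (localTwoShellRigidityW_of_tightW (by norm_num) (by norm_num) hK))
  rdef_of_grossU_periodicSplit Λ hG hCEG hC (optimalTexturePeriodic_of_doorPeriodicW h₁ h₂ hD)
    (periodicStrainedCubes_of_layered (by norm_num) (layeredCleanOrStrained_of_balancedW (by norm_num) h₁ hB)) hCE hR

/-- The literal slot 4 still feeds the eleventh form (`tightDozenRigidity_imp_W`). [this file] -/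
theorem rdef_of_grossU_doorPeriodicW_balanced_literal (Λ : ℝ) (hG : GrossCleanBallsU (1 / 250) 10) (hCEG : ChargedEnergyGap)
    (hC : CompressedVirialLaw (1 / 250) 10) (hK : TightDozenRigidity (1 / 250)) (h₂ : CleanChartedW (1 / 250) 10) (hD : DoorPeriodicW Λ)
    (hB : BalancedLayeredCleanW Λ) (hCE : CleanlessExcessT) (hR : CoherentResidual 10) : RobustDefectLimitWindows :=
  rdef_of_grossU_doorPeriodicW_balanced Λ hG hCEG hC (tightDozenRigidity_imp_W hK) h₂ hD hB hCE hR

end Summit.AtomisticToContinuum.Crystallization.Theorems.OverbindingBudgetScaleWidening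

end
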